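import Mathlib
import Literature.NumberTheory.Transcendental.KZCalculus
import Literature.NumberTheory.Transcendental.KZLogCalculusProofs
import Literature.NumberTheory.Transcendental.KZDominatedFamilyRelations
import Literature.NumberTheory.Transcendental.KZSemialgebraicComplex
import Literature.NumberTheory.Transcendental.SemialgebraicMapsProofs
import Literature.NumberTheory.Transcendental.EllIterRep
import Summits.KontsevichZagierPeriods.KontsevichZagierPeriods.Theorems.TorsionLogsGKZLevelThreePairTChainSubst

/-!
# Route TorsionLogs — support item `GKZLevelThreePair`: the T-chain, step (N2) (the affine chart)
# (`[square, 3(1+x)/Y] ∼ [band {0 ≤ s ≤ 2x√x/(1+x³)}, (3/2)(1+x)/(x√x√(1-s²))]`)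

Helper file for item `stmt-KontsevichZagierPeriods-13812` (`GKZLevelThreePair`), blueprint v3. On
the hyperelliptic model `Y² = x⁶ + 2(1-2y²)x³ + 1 = (x³+1)² - 4y²x³` of the level-3 Euler curve,
the fibrewise AFFINE substitution `y = s · (x³+1)/(2x√x)` over the base `x ∈ (0,1)` turns `Y` into
`(x³+1)√(1-s²)`, so that

  `[ {0<x<1, 0≤y≤1}, 3(1+x)/Y ] ∼ [ {0<x<1, 0 ≤ s ≤ 2x√x/(1+x³)}, (3/2)(1+x)/(x√x · √(1-s²)) ]`

(`square_band_equivalent_sband`: ONE instance of Kontsevich–Zagier's rule 2),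
`KZ.of_sub_of_mem_relations_of_affine`), the integrand becoming a PRODUCT whose `x`-primitive
`3(√x - 1/√x)/√(1-s²)` is algebraic (used by the Newton–Leibniz step (N3), `…TChainNL.lean`).
`square_equivalent_square_band` discards the null edges `y = 0`, `y = 1` (rule 1)).
All representations are PINNED by their domain and their integrand on it.

## References

* M. Kontsevich, D. Zagier, *Periods* (2001), §1.2 rules (1), (2).
-/

-- `Summit.<Summit>.<Sub>` with Sub = Summit (single-conjunct summit, D-0017) duplicates the segment.
set_option linter.dupNamespace false

noncomputable section

namespace Summit.KontsevichZagierPeriods.KontsevichZagierPeriods.Theorems.GKZLevelThree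

open Set MeasureTheory
open MvPolynomial (aeval X C)
open Literature.NumberTheory.Transcendental Literature.NumberTheory.Transcendental.KZ
open Literature.ModelTheory.ExponentialFields (IsSemialgebraic isSemialgebraic_setOf_eval_pos)

/-! ## The base `(0,1) ∋ x` -/

/-- The base interval `G = {0 < x₀ < 1} ⊆ ℝ¹` is open. -/
theorem isOpen_baseIoo : IsOpen {p : Fin 1 → ℝ | 0 < p 0 ∧ p 0 < 1} := by
  have : {p : Fin 1 → ℝ | 0 < p 0 ∧ p 0 < 1} = (fun p : Fin 1 → ℝ => p 0) ⁻¹' Ioo 0 1 := by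
    ext p; simp [mem_Ioo]
  rw [this]
  exact isOpen_Ioo.preimage (continuous_apply 0)

/-- `2x√x/(1+x³) < 1` for `0 < x < 1` (the edge of the band stays below the level `s = 1`). -/
theorem tailSubst_lt_one {x : ℝ} (hx0 : 0 < x) (hx1 : x < 1) : 2 * (x * Real.sqrt x) / (1 + x ^ 3) < 1 := by
  have h : (fun r : ℝ => 2 * (r * Real.sqrt r) / (1 + r ^ 3)) x ∈
      (fun r : ℝ => 2 * (r * Real.sqrt r) / (1 + r ^ 3)) '' Ioo 0 1 :=
    mem_image_of_mem _ (show x ∈ Ioo (0:ℝ) 1 from ⟨hx0, hx1⟩)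
  rw [image_tailSubst] at h
  exact h.2

/-! ## The open square and the closed-fibre band differ by a null set -/

/-- **`[(0,1)², f] ∼ [{0<x<1, 0≤y≤1}, f]`**: the band with closed fibres exceeds the open square by
the two edges `y = 0`, `y = 1`, which are Lebesgue-null (rule 1a)). [Kontsevich–Zagier 2001, §1.2 rule (1)] -/
theorem square_equivalent_square_band (f : (Fin 2 → ℝ) → ℝ) (R Rband : IntegralRep 2)
    (hRd : R.domain = {z | (0 < z 0 ∧ z 0 < 1) ∧ (0 < z 1 ∧ z 1 < 1)})
    (hRi : EqOn R.integrand f R.domain)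
    (hBd : Rband.domain = KZlog.band {p : Fin 1 → ℝ | 0 < p 0 ∧ p 0 < 1} (fun _ => 0) (fun _ => 1))
    (hBi : EqOn Rband.integrand f Rband.domain) : Equivalent R Rband := by
  have hsub : R.domain ⊆ Rband.domain := by
    rw [hRd, hBd]
    intro z hz
    exact ⟨hz.1, hz.2.1.le, hz.2.2.le⟩
  have hvol : volume (Rband.domain \ R.domain) = 0 := by
    have h0 : volume {z : Fin 2 → ℝ | z (Fin.last 1) = 0} = 0 := KZ.volume_setOf_last_eq_zero 0
    have h1 : volume {z : Fin 2 → ℝ | z (Fin.last 1) = 1} = 0 := KZ.volume_setOf_last_eq_zero 1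
    refine measure_mono_null (fun z hz => ?_) (measure_union_null h0 h1)
    rw [hBd, hRd] at hz
    obtain ⟨⟨hG, ha, hb⟩, hnot⟩ := hz
    simp only [mem_setOf_eq, not_and, not_lt] at hnot
    have hG' : 0 < z 0 ∧ z 0 < 1 := hG
    have ha' : (0:ℝ) ≤ z (Fin.last 1) := ha
    have hb' : z (Fin.last 1) ≤ 1 := hb
    have hlast : (Fin.last 1 : Fin 2) = 1 := rfl
    rw [hlast] at ha' hb' ⊢
    simp only [mem_union, mem_setOf_eq]
    rcases ha'.lt_or_eq with h | h
    · right
      exact le_antisymm hb' (hnot hG' h)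
    · left; exact h.symm
  have h1 : of Rband - of (Rband.restrict R.domain R.isSemialgebraic_domain hsub) ∈ relations :=
    Rband.of_sub_of_restrict_mem_relations R.isSemialgebraic_domain hsub hvol
  have h2 : of (Rband.restrict R.domain R.isSemialgebraic_domain hsub) - of R ∈ relations :=
    of_sub_of_mem_relations_of_eqOn rfl fun z hz => by
      rw [IntegralRep.integrand_restrict, hBi (hsub hz), hRi hz]
  have : of R - of Rband = -((of Rband - of (Rband.restrict R.domain R.isSemialgebraic_domain hsub)) +
      (of (Rband.restrict R.domain R.isSemialgebraic_domain hsub) - of R)) := by abel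
  show of R - of Rband ∈ relations
  rw [this]
  exact relations.neg_mem (relations.add_mem h1 h2)

/-! ## The affine chart `y = s(x³+1)/(2x√x)` -/

/-- The coefficient `β(x) = (1+x³)/(2x√x)` of the affine chart has a derivative at every `x > 0`
(hence `β` is differentiable on the base). -/
theorem differentiableAt_affineCoeff {x : ℝ} (hx : 0 < x) :
    DifferentiableAt ℝ (fun x : ℝ => (1 + x ^ 3) / (2 * (x * Real.sqrt x))) x := by
  have h1 : DifferentiableAt ℝ (fun x : ℝ => 1 + x ^ 3) x := by fun_prop
  have h2 : DifferentiableAt ℝ (fun x : ℝ => 2 * (x * Real.sqrt x)) x :=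
    ((differentiableAt_id.mul (Real.hasDerivAt_sqrt hx.ne').differentiableAt).const_mul 2)
  exact h1.div h2 (by positivity)

/-- **Step (N2): the affine chart.** For the band representation in the `s`-variable
`R₃ = [{0<x<1, 0 ≤ s ≤ 2x√x/(1+x³)}, (3/2)(1+x)/(x√x√(1-s²))]` and the unit band
`R₂ = [{0<x<1, 0 ≤ y ≤ 1}, 3(1+x)/√((x³+1)² - 4y²x³)]` (both pinned), `R₃ ∼ R₂` by ONE change of
variables `y = β(x)·s`, `β = (1+x³)/(2x√x) > 0` (rule 2), `KZ.of_sub_of_mem_relations_of_affine`):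
`(x³+1)² - 4(βs)²x³ = (x³+1)²(1-s²)`. [Kontsevich–Zagier 2001, §1.2 rule (2)] -/
theorem sband_equivalent_square_band (R₃ R₂ : IntegralRep 2)
    (h3d : R₃.domain = KZlog.band {p : Fin 1 → ℝ | 0 < p 0 ∧ p 0 < 1} (fun _ => 0)
      (fun p => 2 * (p 0 * Real.sqrt (p 0)) / (1 + p 0 ^ 3)))
    (h3i : EqOn R₃.integrand (fun z => 3 / 2 * (1 + z 0) / (z 0 * Real.sqrt (z 0) * Real.sqrt (1 - z 1 ^ 2)))
      R₃.domain)
    (h2d : R₂.domain = KZlog.band {p : Fin 1 → ℝ | 0 < p 0 ∧ p 0 < 1} (fun _ => 0) (fun _ => 1))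
    (h2i : EqOn R₂.integrand (fun z => 3 * (1 + z 0) / Real.sqrt ((z 0 ^ 3 + 1) ^ 2 - 4 * z 1 ^ 2 * z 0 ^ 3))
      R₂.domain) : Equivalent R₃ R₂ := by
  set G : Set (Fin 1 → ℝ) := {p | 0 < p 0 ∧ p 0 < 1} with hG
  set β : (Fin 1 → ℝ) → ℝ := fun p => (1 + p 0 ^ 3) / (2 * (p 0 * Real.sqrt (p 0))) with hβ
  set α : (Fin 1 → ℝ) → ℝ := fun _ => 0 with hα
  have hGs : IsSemialgebraic ℚ G := isSemialgebraic_unitInterval_fin_one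
  have hβpos : ∀ p ∈ G, 0 < β p := fun p hp => by
    have := hp.1
    simp only [hβ]
    positivity
  -- semialgebraicity and differentiability of the coefficients
  have hαs : IsSemialgebraicFunOn ℚ G α := by
    simpa [hα] using isSemialgebraicFunOn_const_of_isAlgebraic hGs isAlgebraic_zero
  have hβs : IsSemialgebraicFunOn ℚ G β := by
    have hX : IsSemialgebraicFunOn ℚ G (fun p => p 0) :=
      (isSemialgebraicFunOn_aeval hGs (X 0 : MvPolynomial (Fin 1) ℚ)).congr fun z _ => by simp
    have hsq : IsSemialgebraicFunOn ℚ G (fun p => Real.sqrt (p 0)) := IsSemialgebraicFunOn.sqrt_holds hX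
    have h2 : IsSemialgebraicFunOn ℚ G (fun _ => (2:ℝ)) := by
      simpa using isSemialgebraicFunOn_const_of_isAlgebraic hGs (isAlgebraic_nat (R := ℚ) (A := ℝ) 2)
    have hden : IsSemialgebraicFunOn ℚ G (fun p => 2 * (p 0 * Real.sqrt (p 0))) :=
      (IsSemialgebraicFunOn.mul_holds h2 (IsSemialgebraicFunOn.mul_holds hX hsq)).congr fun p _ => rfl
    have hnum : IsSemialgebraicFunOn ℚ G (fun p => 1 + p 0 ^ 3) :=
      (isSemialgebraicFunOn_aeval hGs (1 + X 0 ^ 3 : MvPolynomial (Fin 1) ℚ)).congr fun z _ => by simp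
    exact (hnum.div hden fun p hp => by have := hp.1; positivity).congr fun p _ => rfl
  have hαd : DifferentiableOn ℝ α G := differentiableOn_const 0
  have hβd : DifferentiableOn ℝ β G := by
    intro p hp
    have h := (differentiableAt_affineCoeff hp.1).comp_differentiableWithinAt (s := G) (x := p)
      ((differentiableAt_apply (𝕜 := ℝ) 0 p).differentiableWithinAt)
    exact h
  -- the move
  refine of_sub_of_mem_relations_of_affine isOpen_baseIoo hαs hβs hαd hβd hβpos R₃ R₂ h3d h2d
    (fun p _ => by simp [hα]) (fun p hp => ?_) (fun z hz => ?_)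
  · -- `1 = β · 2x√x/(1+x³)`
    have hx := hp.1
    symm
    simp only [hα, hβ, zero_add]
    rw [div_mul_div_comm, mul_comm ((1:ℝ) + p 0 ^ 3), div_self (by positivity)]
  · -- the integrands
    rw [h3d] at hz
    obtain ⟨hxG, hs0, hs1⟩ := hz
    have hx0 : 0 < (Fin.init z) 0 := hxG.1
    have hx1 : (Fin.init z) 0 < 1 := hxG.2
    have hinit : (Fin.init z) 0 = z 0 := rfl
    have hlast : (Fin.last 1 : Fin 2) = 1 := rfl
    rw [hinit] at hx0 hx1
    rw [hlast] at hs0 hs1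
    have hs0' : (0:ℝ) ≤ z 1 := hs0
    have hs1' : z 1 ≤ 2 * (z 0 * Real.sqrt (z 0)) / (1 + z 0 ^ 3) := hs1
    have hslt : z 1 < 1 := hs1'.trans_lt (tailSubst_lt_one hx0 hx1)
    have hzmem : z ∈ R₃.domain := by rw [h3d]; exact ⟨hxG, hs0, hs1⟩
    set y : ℝ := α (Fin.init z) + β (Fin.init z) * z (Fin.last 1) with hy
    have hymem : (Fin.snoc (Fin.init z) y : Fin 2 → ℝ) ∈ R₂.domain := by
      rw [h2d]
      refine ⟨by simpa using hxG, ?_, ?_⟩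
      · show (0:ℝ) ≤ (Fin.snoc (Fin.init z) y : Fin 2 → ℝ) (Fin.last 1)
        rw [Fin.snoc_last, hy, hα]
        have := hβpos _ hxG
        positivity
      · show (Fin.snoc (Fin.init z) y : Fin 2 → ℝ) (Fin.last 1) ≤ 1
        rw [Fin.snoc_last, hy, hα, hlast]
        simp only [zero_add, hβ, hinit]
        rw [div_mul_eq_mul_div, div_le_one (by positivity)]
        calc (1 + z 0 ^ 3) * z 1 ≤ (1 + z 0 ^ 3) * (2 * (z 0 * Real.sqrt (z 0)) / (1 + z 0 ^ 3)) :=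
              mul_le_mul_of_nonneg_left hs1' (by positivity)
          _ = 2 * (z 0 * Real.sqrt (z 0)) := by field_simp
    rw [h3i hzmem, h2i hymem]
    simp only [hlast, hy, hα, hβ, hinit, zero_add]
    have hsn0 : (Fin.snoc (Fin.init z) ((1 + z 0 ^ 3) / (2 * (z 0 * Real.sqrt (z 0))) * z 1) : Fin 2 → ℝ) 0 = z 0 := by
      simp [Fin.snoc]; rfl
    rw [hsn0]
    show 3 / 2 * (1 + z 0) / (z 0 * Real.sqrt (z 0) * Real.sqrt (1 - z 1 ^ 2)) =
      3 * (1 + z 0) / Real.sqrt ((z 0 ^ 3 + 1) ^ 2 -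
        4 * ((1 + z 0 ^ 3) / (2 * (z 0 * Real.sqrt (z 0))) * z 1) ^ 2 * z 0 ^ 3) *
        ((1 + z 0 ^ 3) / (2 * (z 0 * Real.sqrt (z 0))))
    -- write `z 0 = q²`
    obtain ⟨q, hq0, hzq⟩ : ∃ q : ℝ, 0 < q ∧ z 0 = q ^ 2 :=
      ⟨Real.sqrt (z 0), Real.sqrt_pos.2 hx0, (Real.sq_sqrt hx0.le).symm⟩
    have h1z : 0 < 1 - z 1 ^ 2 := by nlinarith
    have hs2 : 0 < Real.sqrt (1 - z 1 ^ 2) := Real.sqrt_pos.2 h1z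
    rw [hzq, Real.sqrt_sq hq0.le]
    have hrad : ((q ^ 2) ^ 3 + 1) ^ 2 - 4 * ((1 + (q ^ 2) ^ 3) / (2 * (q ^ 2 * q)) * z 1) ^ 2 * (q ^ 2) ^ 3 =
        ((1 + (q ^ 2) ^ 3) * Real.sqrt (1 - z 1 ^ 2)) ^ 2 := by
      rw [mul_pow ((1:ℝ) + (q ^ 2) ^ 3), Real.sq_sqrt h1z.le]
      field_simp
      ring
    rw [hrad, Real.sqrt_sq (by positivity)]
    field_simp

end Summit.KontsevichZagierPeriods.KontsevichZagierPeriods.Theorems.GKZLevelThree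

end
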